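import Mathlib.Geometry.Manifold.Instances.Sphere
import Literature.Geometry.Lorentzian.TrappedSurface
import Literature.Geometry.Lorentzian.SpacetimeLocalConvergence
import HarnessLib

/-!
# Red-shifted collars of the holes of a final-state decomposition

Vocabulary for route `FinalStateConjecture/SpectralSurfaceGravity` (definition request
`defn-Spacetime.RedShiftedCollar`, card *quasilocal-surface-gravity-mots-redshift*), next to
`QuasiFinalStateDecomposition`, `RedShiftedHorizon` and `TrappedSurface`.

A hole of a typed final-state decomposition (`FinalStateDecomposition`: boosted Kerr charts
`chart i : boostedKerrExterior Λᵢ cᵢ Mᵢ aᵢ → 𝓢.carrier` on the EXTERIORS `{rᵢ > r₊(Mᵢ, aᵢ)}`) has a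
**red-shifted collar** when (i) its rest-frame Kerr–Schild chart extends across `r = r₊` to the
coordinate collar `C = {t* > τ₀, |r − r₊(M, a)| < η}` as a `C³` open embedding `Φ` with, from a
later time `τ₁` on, a `C³`-bounded pulled-back metric whose `t*`-slices are uniformly spacelike and
which is uniformly timelike on some coordinate direction (the geometry in which the
Dafermos–Rodnianski red-shift vector field lives: arXiv:0811.0354, §3.3 and §7.1, Thm. 7.1, whose
only input is the positivity of the surface gravity `κ`); and (ii) the extended slices
`{t* = τ}`, `τ > τ₁`, carry a `C⁴`-bounded radial-graph tube of spheres `n ↦ Φ(τ, ρ(τ, n) n)`,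
achronal, asymptotically not inside the reference horizon radius (`r > r₊ − ε` eventually, every
`ε > 0`), whose sections are MARGINALLY TRAPPED (`θ_ℓ = 0`, `θ_k < 0`, `TrappedSurface.lean`) for
a null pair `(ℓ, k)`, `g(ℓ, k) = −2`, normalised by the chart clock (`ℓ = dΦ(v)`, `v⁰ = 1`), and
whose QUASI-LOCAL SURFACE GRAVITY is `≥ κ > 0` uniformly: there are `ψ : S² → [m, 1]` and a `C²`
deformation of the section with initial velocity `−ψ k` along which
`d/ds θ_ℓ ≥ κ · (−θ_k) · ψ` — a positive supersolution of the null-inward pencil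
`δ_{ψ(−k)} θ_ℓ = κ (−θ_k) ψ` of the Andersson–Mars–Simon stability operator (ATMP 12 (2008):
Lemma 3.1, first variation of `θ_ℓ`; Def. 3.1 and Lemma 3.2, `δ_{ψv} θ_ℓ = L_v ψ` on a MOTS,
`L_v = ½ L_{−k} − V W`; Lemma 4.1, principal eigenvalue; Def. 5.1 / Prop. 5.1, positive
supersolutions versus the sign of the principal eigenvalue). On an axisymmetric isolated (e.g.
Kerr) horizon this number is the surface gravity (Jaramillo, arXiv:1206.1271, Lemma 1:
`δ_{ψ(−k_o)} θ^{(ℓ_o)} = −κ^{(ℓ)} θ^{(k_o)}`; Booth–Fairhurst 2007; Mars 2012).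

## Contents (namespace `Literature.Geometry.Lorentzian`)

* `Spacetime.RedShiftedCollar 𝓢 Λ c M a τ₀ chart : Prop` — THE REQUESTED NOTION. Its body is
  VERBATIM the `let`-bound block `RSC` at the head of the items `HorizonSubextremal` and
  `GenericRedShiftedSettling` of the route (the `Literature.Geometry.Lorentzian.` qualifiers are
  dropped and the universe of `𝓢` is generalised from `0` to `u`), so that those items can be
  restated by NAME: `RSC 𝓢 Λ c M a τ₀ chart ↔ 𝓢.RedShiftedCollar Λ c M a τ₀ chart` and
  "`HorizonSubextremal` ↔ its restatement by name" hold by `Iff.rfl` (checked in a scratch file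
  against the route file at filing).
* Named pieces of the block for the provers who must USE or BUILD a collar:
  `Kerr.horizonCollar M a τ₀ η` (the set `C`; `isOpen_horizonCollar`, `horizonCollar_mono`),
  `radialGraph ρ τ n = (τ, ρ(τ, n) n)` (the section map `sec`), `radialGraphTube Φ ρ τ₁` (the
  tube `T`), and the HYPOTHESIS STRUCTURE `Spacetime.RedShiftedCollarWitness 𝓢 Λ c M a τ₀ chart`:
  the eight witnesses `η κ m b B τ₁ Φ ρ` and the fifteen clauses as documented fields, with
  `Spacetime.metricInCoords 𝓢 Φ` (`SpacetimeLocalConvergence.lean`) for `gC = Φ^* g`.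
* `Spacetime.redShiftedCollar_iff_nonempty_witness` (both directions also separately), first
  consequences (`RedShiftedCollarWitness.τ₀_le_τ₁`, `horizonCollar_nonempty`,
  `radialGraphTube_subset_image`, …), and MONOTONICITY IN `τ₀`: `RedShiftedCollarWitness.ofLE`,
  `RedShiftedCollar.of_le` (a collar from `τ₀` on is one from every later `τ₀'` on).

## Design choices

* **Verbatim first.** The request is a naming device for a 2.2k-character block repeated in the
  route's items; faithfulness is syntactic identity, so the `def` keeps the block's `let`s and
  clause order, and all structure (names, one docstring per clause) is carried by the companion
  `RedShiftedCollarWitness`, proved equivalent by unfolding. In particular the pencil clause stays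
  INLINED: the separate request `LorentzianMetric.NullInwardPencilGe` is not yet in the tree, and
  in the block the null pair at `s = 0` is bound together with the deformation's pairs and carries
  the extra clock clause, so the bridge to that notion will be a short lemma, not a `rfl`.
* **Signature.** `chart` enters only through the compatibility clause
  `EqOn chart (Φ ∘ poincareInv Λ c ∘ Subtype.val) {x | poincareInv Λ c x ∈ C}` (`Φ`, in
  rest-frame coordinates, reproduces the hole chart over the collar); `τ₀` only through `C`. The
  Summit-side companion `RedShiftedSkeleton` (a `FinalStateDecomposition` all of whose holes
  have red-shifted collars, with the Statement's `exteriorOf`/`HasExhaustiveCharts` clauses) uses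
  Summit vocabulary and is NOT here (Literature does not import `Summits`).
* **Normalisations** (the number `κ` depends on them): `g(ℓ, k) = −2` (`NullNormalPair`); `ℓ` is
  pinned by the chart clock, `ℓ = dΦ(v)` with `v⁰ = 1` (under `ℓ ↦ c ℓ` the level scales
  `κ ↦ c κ`); the deformation's normals `L_s` are `C⁰` in `(s, n)` with `L_0 = ℓ` for the same
  reason; `ψ ∈ [m, 1]`, `m > 0`, is the Harnack normalisation of the positive supersolution.
* **Regularity bookkeeping** as in `TrappedSurface.lean` ("M5 migration"): the pencil clause
  binds `[𝓢.metric.HasLeviCivita]` and the smoothness fact `hpb` of induced metrics innermost;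
  both are inhabited (`PseudoRiemannianMetric.hasLeviCivita`), so quantifying over them is not
  vacuous. `S² = Metric.sphere (0 : E3) 1` carries Mathlib's manifold structure (`𝓡 2`).
* **Anti-vacuity notes.** `η` is not required small (for `η > r₊` the "collar" is a solid
  cylinder); this does not trivialise the predicate, since the sections must be marginally
  trapped for all `τ > τ₁` AND eventually lie in `{r > r₊ − ε}` for every `ε > 0`. For junk
  parameters (`M ≤ 0`, or `|a| > M` where `Kerr.rPlus` has the junk value `M`) the predicate is
  meaningful but uninteresting; users have `0 < M`, `|a| ≤ M` from `FinalStateDecomposition`. No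
  instance is constructed here (for exact Kerr that is the route's item `KerrCalibration`).

## What is NOT here

`LorentzianMetric.NullInwardPencilGe` (separate request), the Summit-side `RedShiftedSkeleton`, and
every theorem of the route (its items are not Literature). (Re-basing a collar to a later `τ₀'`
IS here: `RedShiftedCollarWitness.ofLE`, `RedShiftedCollar.of_le`.)

## References

* L. Andersson, M. Mars, W. Simon, *Stability of marginally outer trapped surfaces and existence
  of marginally outer trapped tubes*, Adv. Theor. Math. Phys. 12 (2008) 853–888, arXiv:0704.2889:
  Lemma 3.1, Def. 3.1, Lemma 3.2, Lemma 4.1, Def. 5.1, Prop. 5.1 (key `AnderssonMarsSimon2008`).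
* M. Dafermos, I. Rodnianski, *Lectures on black holes and linear waves*, Clay Math. Proc. 17
  (2013), arXiv:0811.0354, §3.3 and §7.1, Thm. 7.1 (key `DafermosRodnianski2008`).
* J. L. Jaramillo, *A note on degeneracy, marginal stability and extremality of black hole
  horizons*, CQG 29 (2012) 177001, arXiv:1206.1271, Lemma 1 (key `Jaramillo2012`).
* I. Booth, S. Fairhurst, arXiv:0708.2209 (`BoothFairhurst2007`); M. Mars, CQG 29 (2012) 145019
  (`Mars2012`).
-/


noncomputable section

open Set Function Bundle
open scoped Manifold ContDiff Topology ENNReal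

universe u

namespace Literature.Geometry.Lorentzian

/-! ### Named pieces: the coordinate collar, radial graphs, the tube -/

namespace Kerr

/-- The **rest-frame Kerr–Schild horizon collar** `{z ∈ E4 | τ₀ < z⁰, |r(a, z) − r₊(M, a)| < η}`:
the points of Kerr–Schild coordinate space after time `τ₀` whose Kerr–Schild radius
(`Kerr.radius`) is within `η` of the outer horizon radius `r₊ = M + √(M² − a²)` (`Kerr.rPlus`).
The coordinate version of the neighbourhood of the horizon on which the red-shift vector field
`N` is constructed (Dafermos–Rodnianski, arXiv:0811.0354, §7.1, Thm. 7.1: "in an open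
`φ_t`-invariant subset `𝒰̃ ⊂ 𝓡′` containing `𝓗 ∩ 𝓡′`", given `κ > 0`), two-sided here because
the chart is extended across the horizon. [cite: DafermosRodnianski2008, §7.1] -/
def horizonCollar (M a τ₀ η : ℝ) : Set E4 :=
  {z | τ₀ < z 0 ∧ |radius a z - rPlus M a| < η}

/-- Membership in the horizon collar (unfolding). [cite: DafermosRodnianski2008, §7.1] -/
@[simp]
theorem mem_horizonCollar_iff {M a τ₀ η : ℝ} {z : E4} :
    z ∈ horizonCollar M a τ₀ η ↔ τ₀ < z 0 ∧ |radius a z - rPlus M a| < η :=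
  Iff.rfl

/-- The horizon collar is open in `E4` (the Kerr–Schild radius is continuous,
`Kerr.continuous_radius`). [cite: DafermosRodnianski2008, §7.1] -/
theorem isOpen_horizonCollar (M a τ₀ η : ℝ) : IsOpen (horizonCollar M a τ₀ η) := by
  have h0 : Continuous fun z : E4 ↦ z 0 := by fun_prop
  exact (isOpen_lt continuous_const h0).inter
    (isOpen_lt ((continuous_radius a).sub continuous_const).abs continuous_const)

/-- The horizon collar shrinks when `τ₀` increases and grows with `η`.
[cite: DafermosRodnianski2008, §7.1] -/
theorem horizonCollar_mono {M a τ₀ τ₀' η η' : ℝ} (hτ : τ₀ ≤ τ₀') (hη : η' ≤ η) :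
    horizonCollar M a τ₀' η' ⊆ horizonCollar M a τ₀ η :=
  fun _ hz ↦ ⟨hτ.trans_lt hz.1, hz.2.trans_le hη⟩

/-- Points of the collar are later than `τ₀`. [cite: DafermosRodnianski2008, §7.1] -/
theorem lt_apply_zero_of_mem_horizonCollar {M a τ₀ η : ℝ} {z : E4}
    (hz : z ∈ horizonCollar M a τ₀ η) : τ₀ < z 0 :=
  hz.1

/-- On the collar the Kerr–Schild radius is within `η` of `r₊`; in particular the collar is
empty unless `0 < η`. [cite: DafermosRodnianski2008, §7.1] -/
theorem pos_of_mem_horizonCollar {M a τ₀ η : ℝ} {z : E4} (hz : z ∈ horizonCollar M a τ₀ η) :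
    0 < η :=
  (abs_nonneg _).trans_lt hz.2

end Kerr

/-- The **radial-graph section map** of a radius function `ρ : ℝ → E3 → ℝ` (only its values on
unit vectors matter): `radialGraph ρ τ n = (τ, ρ(τ, n) · n) ∈ E4`, the point of the coordinate
slice `{x⁰ = τ}` at Euclidean radius `ρ(τ, n)` in the direction `n ∈ S²`. The sections of the
marginally trapped tubes of the route are such radial graphs over `S²` (star-shaped spheres in
Kerr–Schild coordinates; Andersson–Mars–Simon 2008, §6 "The graph representation of MOTS", and
§9, MOTTs as graphs over a reference MOTS). [cite: AnderssonMarsSimon2008, §6] -/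
def radialGraph (ρ : ℝ → E3 → ℝ) (τ : ℝ) (n : Metric.sphere (0 : E3) 1) : E4 :=
  E4.ofTimeSpace τ (ρ τ n • (n : E3))

/-- The time coordinate of a radial-graph point is `τ`. [folklore] -/
@[simp]
theorem radialGraph_apply_zero (ρ : ℝ → E3 → ℝ) (τ : ℝ) (n : Metric.sphere (0 : E3) 1) :
    radialGraph ρ τ n 0 = τ :=
  rfl

/-- The spatial part of a radial-graph point is `ρ(τ, n) · n`. [folklore] -/
@[simp]
theorem spatial_radialGraph (ρ : ℝ → E3 → ℝ) (τ : ℝ) (n : Metric.sphere (0 : E3) 1) :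
    E4.spatial (radialGraph ρ τ n) = ρ τ n • (n : E3) := by
  simp [radialGraph]

/-- The Euclidean spatial radius of a radial-graph point is `|ρ(τ, n)|` (`‖n‖ = 1`). [folklore] -/
@[simp]
theorem spatialNorm_radialGraph (ρ : ℝ → E3 → ℝ) (τ : ℝ) (n : Metric.sphere (0 : E3) 1) :
    E4.spatialNorm (radialGraph ρ τ n) = |ρ τ n| := by
  rw [E4.spatialNorm, spatial_radialGraph, norm_smul, norm_eq_of_mem_sphere n, mul_one,
    Real.norm_eq_abs]

/-- The **late radial-graph tube** of `ρ` through the map `Φ : E4 → X` after time `τ₁`: the image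
`{Φ (τ, ρ(τ, n) n) | τ > τ₁, n ∈ S²}` of all sections after `τ₁` (a marginally outer trapped
tube in the sense of Andersson–Mars–Simon 2008, Def. 2.2, seen in the collar
chart). [cite: AnderssonMarsSimon2008, Def. 2.2] -/
def radialGraphTube {X : Type*} (Φ : E4 → X) (ρ : ℝ → E3 → ℝ) (τ₁ : ℝ) : Set X :=
  (fun q : ℝ × Metric.sphere (0 : E3) 1 ↦ Φ (radialGraph ρ q.1 q.2)) '' (Ioi τ₁ ×ˢ univ)

/-- Membership in the late tube: `p = Φ (τ, ρ(τ, n) n)` for some `τ > τ₁`, `n ∈ S²`. [folklore] -/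
theorem mem_radialGraphTube_iff {X : Type*} {Φ : E4 → X} {ρ : ℝ → E3 → ℝ} {τ₁ : ℝ} {p : X} :
    p ∈ radialGraphTube Φ ρ τ₁ ↔
      ∃ τ, τ₁ < τ ∧ ∃ n : Metric.sphere (0 : E3) 1, Φ (radialGraph ρ τ n) = p := by
  constructor
  · rintro ⟨⟨τ, n⟩, ⟨hτ, -⟩, rfl⟩
    exact ⟨τ, hτ, n, rfl⟩
  · rintro ⟨τ, hτ, n, rfl⟩
    exact ⟨(τ, n), ⟨hτ, mem_univ _⟩, rfl⟩

/-- Sections after `τ₁` lie on the late tube. [folklore] -/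
theorem apply_radialGraph_mem_radialGraphTube {X : Type*} (Φ : E4 → X) (ρ : ℝ → E3 → ℝ)
    {τ₁ τ : ℝ} (hτ : τ₁ < τ) (n : Metric.sphere (0 : E3) 1) :
    Φ (radialGraph ρ τ n) ∈ radialGraphTube Φ ρ τ₁ :=
  ⟨(τ, n), ⟨hτ, mem_univ _⟩, rfl⟩

/-- The late tube shrinks as `τ₁` increases. [folklore] -/
theorem radialGraphTube_mono {X : Type*} (Φ : E4 → X) (ρ : ℝ → E3 → ℝ) {τ₁ τ₁' : ℝ}
    (h : τ₁ ≤ τ₁') : radialGraphTube Φ ρ τ₁' ⊆ radialGraphTube Φ ρ τ₁ :=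
  image_mono (prod_mono (Ioi_subset_Ioi h) Subset.rfl)

/-! ### The requested predicate (verbatim block of the route) -/

namespace Spacetime

variable (𝓢 : Spacetime.{u} 4)

/-- **Red-shifted collar** of the hole with motion `(Λ, c)`, Kerr parameters `(M, a)`, late time
`τ₀` and exterior chart `chart : boostedKerrExterior Λ c M a → 𝓢.carrier` (route
`FinalStateConjecture/SpectralSurfaceGravity`, verbatim the block `RSC` of its items
`HorizonSubextremal` / `GenericRedShiftedSettling`). There are constants `η, κ, m, b > 0`, `B`,
`τ₁`, a map `Φ : E4 → 𝓢.carrier` and a radius function `ρ : ℝ → E3 → ℝ` such that, with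
`C = Kerr.horizonCollar M a τ₀ η = {τ₀ < z⁰, |r(a,z) − r₊(M,a)| < η}`, `gC = Φ^* g` in coordinates,
`sec τ n = (τ, ρ(τ,n) n)`, `A = (τ₁, ∞) × {½ < ‖y‖ < 2}` and `T` the late tube of sections:
(1) `Φ` is `C³` on `C` and (2) an open embedding of `C`; (3) in rest-frame coordinates it
reproduces `chart` over the collar, `chart = Φ ∘ (x ↦ Λ⁻¹(x − c))` on `{Λ⁻¹(x − c) ∈ C}`;
(4) on `C ∩ {z⁰ ≥ τ₁}` the `C³` sup norm of `gC` is `≤ B`, and (5) there the slices are uniformly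
spacelike, `gC(v, v) ≥ b‖v‖²` for `v⁰ = 0`, and some `w`, `‖w‖ ≤ 1`, has `gC(w, w) ≤ −b`;
(6) `ρ` is `C⁴` on `A` with (7) `C⁴` sup norm `≤ B`; (8) the sections after `τ₁` lie in `C`;
(9) for every `ε > 0`, eventually `r(a, sec τ n) > r₊ − ε`; (10) `T` is achronal (no point of `T`
in the chronological future of another); (11) for every `τ > τ₁` (given the Levi-Civita
connection and the smoothness fact `hpb` of induced metrics on maps `S² → 𝓢`): there are
`ψ : S² → ℝ`, a deformation `F : ℝ → S² → 𝓢` by spacelike immersions with null normal pairs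
`P s`, such that `F 0` is the section, `F` is `C²` in `(s, n)`, the outgoing normals `(P s).L`
are `C⁰` in `(s, n)`, the section is MARGINALLY TRAPPED for `P 0` (`θ_L = 0`, `θ_L̲ < 0`),
`m ≤ ψ ≤ 1`, the CLOCK NORMALISATION `(P 0).L n = dΦ(v)` with `v⁰ = 1` holds, the deformation
velocity is `−ψ · (P 0).L̲`, and `d/ds|₀ θ_{(P s).L}(n) ≥ κ · (−θ_{(P 0).L̲}(n)) · ψ(n)` — the
quasi-local surface gravity of every late section is `≥ κ` (positive supersolution of the
null-inward MOTS-stability pencil: Andersson–Mars–Simon 2008, Lemma 3.1, Def. 3.1, Lemma 3.2,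
Def. 5.1 / Prop. 5.1; the surface gravity on axisymmetric isolated horizons, Jaramillo 2012,
Lemma 1; the collar geometry is that of Dafermos–Rodnianski 2008, §7.1, Thm. 7.1). A posited
object of the route: no printed source defines this predicate as a whole.
[cite: AnderssonMarsSimon2008, Lemma 3.1, Def. 3.1, Lemma 3.2, Def. 5.1] -/
def RedShiftedCollar (Λ : lorentzGroup) (c : E4) (M a τ₀ : ℝ)
    (chart : boostedKerrExterior Λ c M a → 𝓢.carrier) : Prop :=
  ∃ (η κ m b B τ₁ : ℝ) (Φ : E4 → 𝓢.carrier) (ρ : ℝ → E3 → ℝ), 0 < η ∧ 0 < κ ∧ 0 < m ∧ 0 < b ∧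
  let r := Kerr.radius a;
  let C : Set E4 := {z | τ₀ < z 0 ∧ |r z - Kerr.rPlus M a| < η};
  let gC : E4 → E4 →L[ℝ] E4 →L[ℝ] ℝ :=
    fun z ↦ pullbackBilin (I := 𝓡 4) (I' := 𝓘(ℝ, E4)) Φ 𝓢.metric.val z;
  let sec : ℝ → Metric.sphere (0 : E3) 1 → E4 := fun τ n ↦ E4.ofTimeSpace τ (ρ τ n • (n : E3));
  let A := Ioi τ₁ ×ˢ {y : E3 | 2⁻¹ < ‖y‖ ∧ ‖y‖ < 2};
  let T := (fun q : ℝ × Metric.sphere (0 : E3) 1 ↦ Φ (sec q.1 q.2)) '' (Ioi τ₁ ×ˢ univ);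
  ContMDiffOn 𝓘(ℝ, E4) (𝓡 4) 3 Φ C ∧ Topology.IsOpenEmbedding (C.restrict Φ) ∧
  EqOn chart (Φ ∘ poincareInv Λ c ∘ Subtype.val) {x | poincareInv Λ c x ∈ C} ∧
  supCkENorm {z ∈ C | τ₁ ≤ z 0} 3 gC ≤ ENNReal.ofReal B ∧
  (∀ z ∈ C, τ₁ ≤ z 0 →
    (∀ v : E4, v 0 = 0 → b * ‖v‖ ^ 2 ≤ gC z v v) ∧ ∃ w : E4, ‖w‖ ≤ 1 ∧ gC z w w ≤ -b) ∧
  ContDiffOn ℝ 4 (uncurry ρ) A ∧ supCkENorm A 4 (uncurry ρ) ≤ ENNReal.ofReal B ∧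
  (∀ τ, τ₁ < τ → ∀ n : Metric.sphere (0 : E3) 1, sec τ n ∈ C) ∧
  (∀ ε > (0 : ℝ), ∃ τ₂ : ℝ, ∀ τ, τ₂ < τ → ∀ n : Metric.sphere (0 : E3) 1,
    Kerr.rPlus M a - ε < r (sec τ n)) ∧
  (∀ p ∈ T, ∀ q ∈ T, q ∉ 𝓢.metric.chronologicalFuture 𝓢.timeOrientation {p}) ∧
  (∀ τ, τ₁ < τ → ∀ [𝓢.metric.HasLeviCivita], ∀ hpb, ∃ (ψ : Metric.sphere (0 : E3) 1 → ℝ)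
    (F : ℝ → Metric.sphere (0 : E3) 1 → 𝓢.carrier)
    (P : ∀ s, LorentzianMetric.NullNormalPair (𝓡 2) 𝓢.metric 𝓢.timeOrientation (F s))
    (hF : ∀ s, 𝓢.metric.IsSpacelikeImmersion (𝓡 2) (F s)),
    (F 0 = fun n ↦ Φ (sec τ n)) ∧ ContMDiff (𝓘(ℝ, ℝ).prod (𝓡 2)) (𝓡 4) 2 (uncurry F) ∧
    ContMDiff (𝓘(ℝ, ℝ).prod (𝓡 2)) (𝓡 4).tangent 0 (fun p : ℝ × Metric.sphere (0 : E3) 1 ↦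
      (Bundle.TotalSpace.mk' E4 (F p.1 p.2) ((P p.1).L p.2) : TangentBundle (𝓡 4) 𝓢.carrier)) ∧
    𝓢.metric.IsMarginallyTrapped hpb (hF 0) (P 0) ∧ (∀ n, m ≤ ψ n ∧ ψ n ≤ 1) ∧
    (∀ n, ∃ v : E4, v 0 = 1 ∧ mfderiv 𝓘(ℝ, E4) (𝓡 4) Φ (sec τ n) v = (P 0).L n) ∧
    (∀ n, mfderiv 𝓘(ℝ, ℝ) (𝓡 4) (fun s ↦ F s n) 0 1 = (-(ψ n)) • (P 0).Lbar n) ∧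
    (∀ n, ∃ D : ℝ, HasDerivAt (fun s ↦ 𝓢.metric.nullExpansion (F s) hpb (hF s) (P s).L n) D 0 ∧
      κ * (-(𝓢.metric.nullExpansion (F 0) hpb (hF 0) (P 0).Lbar n)) * ψ n ≤ D))

/-! ### The same clauses as a hypothesis structure -/

/-- **Witness of a red-shifted collar**: the data `(η, κ, m, b, B, τ₁, Φ, ρ)` and the fifteen
clauses of `Spacetime.RedShiftedCollar 𝓢 Λ c M a τ₀ chart`, as named fields, stated with
`Kerr.horizonCollar`, `Spacetime.metricInCoords`, `radialGraph` and `radialGraphTube`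
(definitionally the `let`s of the block). `𝓢.RedShiftedCollar … ↔ Nonempty (witness)`
(`redShiftedCollar_iff_nonempty_witness`). Sources as for `RedShiftedCollar`.
[cite: AnderssonMarsSimon2008, Lemma 3.1, Def. 3.1, Lemma 3.2, Def. 5.1] -/
structure RedShiftedCollarWitness (Λ : lorentzGroup) (c : E4) (M a τ₀ : ℝ)
    (chart : boostedKerrExterior Λ c M a → 𝓢.carrier) where
  /-- The half-width `η` of the coordinate collar `{|r − r₊| < η}`. -/
  η : ℝ
  /-- The uniform lower bound `κ` on the quasi-local surface gravity of the late sections. -/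
  κ : ℝ
  /-- The Harnack constant: the supersolutions satisfy `m ≤ ψ ≤ 1`. -/
  m : ℝ
  /-- The uniformity constant of the slices (`≥ b‖v‖²`) and of the timelike direction (`≤ −b`). -/
  b : ℝ
  /-- The common `C³` bound of the pulled-back metric and `C⁴` bound of the radius function. -/
  B : ℝ
  /-- The time from which the uniform bounds and the tube clauses hold. -/
  τ₁ : ℝ
  /-- The collar chart: an extension of the rest-frame hole chart across `r = r₊`. -/
  Φ : E4 → 𝓢.carrier
  /-- The radius function of the tube of sections, `(τ, n) ↦ ρ(τ, n)`. -/
  ρ : ℝ → E3 → ℝ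
  /-- `0 < η`. -/
  η_pos : 0 < η
  /-- `0 < κ`: the collar is RED-SHIFTED. -/
  κ_pos : 0 < κ
  /-- `0 < m`. -/
  m_pos : 0 < m
  /-- `0 < b`. -/
  b_pos : 0 < b
  /-- (1) `Φ` is `C³` on the collar. -/
  contMDiffOn : ContMDiffOn 𝓘(ℝ, E4) (𝓡 4) 3 Φ (Kerr.horizonCollar M a τ₀ η)
  /-- (2) `Φ` restricted to the collar is an open embedding. -/
  isOpenEmbedding : Topology.IsOpenEmbedding ((Kerr.horizonCollar M a τ₀ η).restrict Φ)
  /-- (3) `Φ`, read in rest-frame coordinates, reproduces the hole chart over the collar. -/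
  eqOn_chart : EqOn chart (Φ ∘ poincareInv Λ c ∘ Subtype.val)
    {x | poincareInv Λ c x ∈ Kerr.horizonCollar M a τ₀ η}
  /-- (4) From `τ₁` on, the pulled-back metric components are `C³`-bounded by `B`. -/
  supCkENorm_metricInCoords_le :
    supCkENorm {z ∈ Kerr.horizonCollar M a τ₀ η | τ₁ ≤ z 0} 3 (𝓢.metricInCoords Φ) ≤
      ENNReal.ofReal B
  /-- (5) From `τ₁` on, the coordinate slices `{z⁰ = const}` are uniformly spacelike and some
  coordinate direction in the unit ball is uniformly timelike. -/
  uniform : ∀ z ∈ Kerr.horizonCollar M a τ₀ η, τ₁ ≤ z 0 →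
    (∀ v : E4, v 0 = 0 → b * ‖v‖ ^ 2 ≤ 𝓢.metricInCoords Φ z v v) ∧
      ∃ w : E4, ‖w‖ ≤ 1 ∧ 𝓢.metricInCoords Φ z w w ≤ -b
  /-- (6) The radius function is `C⁴` on `(τ₁, ∞) × {½ < ‖y‖ < 2}`. -/
  contDiffOn_ρ : ContDiffOn ℝ 4 (uncurry ρ) (Ioi τ₁ ×ˢ {y : E3 | 2⁻¹ < ‖y‖ ∧ ‖y‖ < 2})
  /-- (7) … with `C⁴` sup norm bounded by `B` there. -/
  supCkENorm_ρ_le :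
    supCkENorm (Ioi τ₁ ×ˢ {y : E3 | 2⁻¹ < ‖y‖ ∧ ‖y‖ < 2}) 4 (uncurry ρ) ≤ ENNReal.ofReal B
  /-- (8) The sections after `τ₁` lie in the collar. -/
  radialGraph_mem : ∀ τ, τ₁ < τ → ∀ n : Metric.sphere (0 : E3) 1,
    radialGraph ρ τ n ∈ Kerr.horizonCollar M a τ₀ η
  /-- (9) The sections are asymptotically not inside the reference horizon radius. -/
  eventually_lt_radius : ∀ ε > (0 : ℝ), ∃ τ₂ : ℝ, ∀ τ, τ₂ < τ → ∀ n : Metric.sphere (0 : E3) 1,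
    Kerr.rPlus M a - ε < Kerr.radius a (radialGraph ρ τ n)
  /-- (10) The late tube of sections is achronal. -/
  achronal : ∀ p ∈ radialGraphTube Φ ρ τ₁, ∀ q ∈ radialGraphTube Φ ρ τ₁,
    q ∉ 𝓢.metric.chronologicalFuture 𝓢.timeOrientation {p}
  /-- (11) Every section after `τ₁` is marginally trapped for a clock-normalised null pair and
  has quasi-local surface gravity `≥ κ`, witnessed by `ψ ∈ [m, 1]` and a `C²` deformation with
  velocity `−ψ L̲` along which `d/ds θ_L ≥ κ (−θ_L̲) ψ`. -/
  pencil : ∀ τ, τ₁ < τ → ∀ [𝓢.metric.HasLeviCivita],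
    ∀ hpb : PseudoRiemannianMetric.contMDiff_pullbackBilin (𝓡 4) 𝓢.carrier (𝓡 2)
      (Metric.sphere (0 : E3) 1) ∞,
    ∃ (ψ : Metric.sphere (0 : E3) 1 → ℝ) (F : ℝ → Metric.sphere (0 : E3) 1 → 𝓢.carrier)
      (P : ∀ s, LorentzianMetric.NullNormalPair (𝓡 2) 𝓢.metric 𝓢.timeOrientation (F s))
      (hF : ∀ s, 𝓢.metric.IsSpacelikeImmersion (𝓡 2) (F s)),
      (F 0 = fun n ↦ Φ (radialGraph ρ τ n)) ∧
      ContMDiff (𝓘(ℝ, ℝ).prod (𝓡 2)) (𝓡 4) 2 (uncurry F) ∧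
      ContMDiff (𝓘(ℝ, ℝ).prod (𝓡 2)) (𝓡 4).tangent 0 (fun p : ℝ × Metric.sphere (0 : E3) 1 ↦
        (Bundle.TotalSpace.mk' E4 (F p.1 p.2) ((P p.1).L p.2) : TangentBundle (𝓡 4) 𝓢.carrier)) ∧
      𝓢.metric.IsMarginallyTrapped hpb (hF 0) (P 0) ∧ (∀ n, m ≤ ψ n ∧ ψ n ≤ 1) ∧
      (∀ n, ∃ v : E4, v 0 = 1 ∧ mfderiv 𝓘(ℝ, E4) (𝓡 4) Φ (radialGraph ρ τ n) v = (P 0).L n) ∧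
      (∀ n, mfderiv 𝓘(ℝ, ℝ) (𝓡 4) (fun s ↦ F s n) 0 1 = (-(ψ n)) • (P 0).Lbar n) ∧
      (∀ n, ∃ D : ℝ,
        HasDerivAt (fun s ↦ 𝓢.metric.nullExpansion (F s) hpb (hF s) (P s).L n) D 0 ∧
          κ * (-(𝓢.metric.nullExpansion (F 0) hpb (hF 0) (P 0).Lbar n)) * ψ n ≤ D)

variable {𝓢}
variable {Λ : lorentzGroup} {c : E4} {M a τ₀ : ℝ} {chart : boostedKerrExterior Λ c M a → 𝓢.carrier}

namespace RedShiftedCollarWitness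

/-- A witness yields the predicate (the block is the witness's clauses, definitionally).
[folklore] -/
theorem redShiftedCollar (w : 𝓢.RedShiftedCollarWitness Λ c M a τ₀ chart) :
    𝓢.RedShiftedCollar Λ c M a τ₀ chart :=
  ⟨w.η, w.κ, w.m, w.b, w.B, w.τ₁, w.Φ, w.ρ, w.η_pos, w.κ_pos, w.m_pos, w.b_pos, w.contMDiffOn,
    w.isOpenEmbedding, w.eqOn_chart, w.supCkENorm_metricInCoords_le, w.uniform, w.contDiffOn_ρ,
    w.supCkENorm_ρ_le, w.radialGraph_mem, w.eventually_lt_radius, w.achronal,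
    fun τ hτ _ hpb ↦ w.pencil τ hτ hpb⟩

/-- The collar of a witness is nonempty from `τ₁` on: it contains the sections. [folklore] -/
theorem horizonCollar_nonempty (w : 𝓢.RedShiftedCollarWitness Λ c M a τ₀ chart) :
    (Kerr.horizonCollar M a τ₀ w.η).Nonempty := by
  obtain ⟨n⟩ : Nonempty (Metric.sphere (0 : E3) 1) :=
    (NormedSpace.sphere_nonempty.mpr zero_le_one).to_subtype
  exact ⟨_, w.radialGraph_mem (w.τ₁ + 1) (lt_add_one _) n⟩

/-- The tube times are later than `τ₀`: `τ₀ ≤ τ₁` fails only vacuously — precisely, every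
`τ > τ₁` exceeds `τ₀` (the sections at time `τ` lie in the collar `{τ₀ < z⁰}`). [folklore] -/
theorem lt_of_τ₁_lt (w : 𝓢.RedShiftedCollarWitness Λ c M a τ₀ chart) {τ : ℝ} (hτ : w.τ₁ < τ) :
    τ₀ < τ := by
  obtain ⟨n⟩ : Nonempty (Metric.sphere (0 : E3) 1) :=
    (NormedSpace.sphere_nonempty.mpr zero_le_one).to_subtype
  simpa using Kerr.lt_apply_zero_of_mem_horizonCollar (w.radialGraph_mem τ hτ n)

/-- `τ₀ ≤ τ₁` for every witness. [folklore] -/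
theorem τ₀_le_τ₁ (w : 𝓢.RedShiftedCollarWitness Λ c M a τ₀ chart) : τ₀ ≤ w.τ₁ :=
  le_of_forall_gt_imp_ge_of_dense fun _ hτ ↦ (w.lt_of_τ₁_lt hτ).le

/-- The sections after `τ₁` have Kerr–Schild radius within `η` of `r₊`. [folklore] -/
theorem abs_radius_radialGraph_sub_rPlus_lt (w : 𝓢.RedShiftedCollarWitness Λ c M a τ₀ chart)
    {τ : ℝ} (hτ : w.τ₁ < τ) (n : Metric.sphere (0 : E3) 1) :
    |Kerr.radius a (radialGraph w.ρ τ n) - Kerr.rPlus M a| < w.η :=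
  (w.radialGraph_mem τ hτ n).2

/-- The late tube lies in the image of the collar under the collar chart. [folklore] -/
theorem radialGraphTube_subset_image (w : 𝓢.RedShiftedCollarWitness Λ c M a τ₀ chart) :
    radialGraphTube w.Φ w.ρ w.τ₁ ⊆ w.Φ '' Kerr.horizonCollar M a τ₀ w.η := by
  rintro _ ⟨⟨τ, n⟩, ⟨hτ, -⟩, rfl⟩
  exact mem_image_of_mem _ (w.radialGraph_mem τ hτ n)

/-- **Re-basing to a later initial time.** A witness of a red-shifted collar from `τ₀` on
restricts to one from any later `τ₀' ≥ τ₀` on: same constants and maps, threshold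
`max τ₁ τ₀'`; the collar shrinks to `{τ₀' < z⁰} ∩ C`, an open subset, so the open embedding
restricts (`Topology.IsOpenEmbedding.inclusion`), and every other clause is monotone. [folklore] -/
def ofLE (w : 𝓢.RedShiftedCollarWitness Λ c M a τ₀ chart) {τ₀' : ℝ} (h : τ₀ ≤ τ₀') :
    𝓢.RedShiftedCollarWitness Λ c M a τ₀' chart :=
  have hsub : Kerr.horizonCollar M a τ₀' w.η ⊆ Kerr.horizonCollar M a τ₀ w.η :=
    Kerr.horizonCollar_mono h le_rfl
  have hA : Ioi (max w.τ₁ τ₀') ×ˢ {y : E3 | 2⁻¹ < ‖y‖ ∧ ‖y‖ < 2} ⊆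
      Ioi w.τ₁ ×ˢ {y : E3 | 2⁻¹ < ‖y‖ ∧ ‖y‖ < 2} :=
    prod_mono (Ioi_subset_Ioi (le_max_left _ _)) Subset.rfl
  have hS : {z ∈ Kerr.horizonCollar M a τ₀' w.η | max w.τ₁ τ₀' ≤ z 0} ⊆
      {z ∈ Kerr.horizonCollar M a τ₀ w.η | w.τ₁ ≤ z 0} :=
    fun _ hz ↦ ⟨hsub hz.1, (le_max_left _ _).trans hz.2⟩
  { η := w.η, κ := w.κ, m := w.m, b := w.b, B := w.B, τ₁ := max w.τ₁ τ₀', Φ := w.Φ, ρ := w.ρ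
    η_pos := w.η_pos, κ_pos := w.κ_pos, m_pos := w.m_pos, b_pos := w.b_pos
    contMDiffOn := w.contMDiffOn.mono hsub
    isOpenEmbedding := w.isOpenEmbedding.comp (Topology.IsOpenEmbedding.inclusion hsub
      ((Kerr.isOpen_horizonCollar M a τ₀' w.η).preimage continuous_subtype_val))
    eqOn_chart := w.eqOn_chart.mono fun _ hx ↦ hsub hx
    supCkENorm_metricInCoords_le :=
      (supCkENorm_mono hS 3 _).trans w.supCkENorm_metricInCoords_le
    uniform := fun z hz hτ ↦ w.uniform z (hsub hz) ((le_max_left _ _).trans hτ)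
    contDiffOn_ρ := w.contDiffOn_ρ.mono hA
    supCkENorm_ρ_le := (supCkENorm_mono hA 4 _).trans w.supCkENorm_ρ_le
    radialGraph_mem := fun τ hτ n ↦
      ⟨(le_max_right _ _).trans_lt hτ, (w.radialGraph_mem τ ((le_max_left _ _).trans_lt hτ) n).2⟩
    eventually_lt_radius := w.eventually_lt_radius
    achronal := fun p hp q hq ↦ w.achronal p (radialGraphTube_mono _ _ (le_max_left _ _) hp) q
      (radialGraphTube_mono _ _ (le_max_left _ _) hq)
    pencil := fun τ hτ _ hpb ↦ w.pencil τ ((le_max_left _ _).trans_lt hτ) hpb }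

/-- The threshold of the re-based witness is `max τ₁ τ₀'`. [folklore] -/
@[simp]
theorem τ₁_ofLE (w : 𝓢.RedShiftedCollarWitness Λ c M a τ₀ chart) {τ₀' : ℝ} (h : τ₀ ≤ τ₀') :
    (w.ofLE h).τ₁ = max w.τ₁ τ₀' :=
  rfl

/-- Re-basing keeps the red-shift constant `κ`. [folklore] -/
@[simp]
theorem κ_ofLE (w : 𝓢.RedShiftedCollarWitness Λ c M a τ₀ chart) {τ₀' : ℝ} (h : τ₀ ≤ τ₀') :
    (w.ofLE h).κ = w.κ :=
  rfl

end RedShiftedCollarWitness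

/-- The predicate yields a witness. [folklore] -/
theorem RedShiftedCollar.nonempty_witness (h : 𝓢.RedShiftedCollar Λ c M a τ₀ chart) :
    Nonempty (𝓢.RedShiftedCollarWitness Λ c M a τ₀ chart) := by
  obtain ⟨η, κ, m, b, B, τ₁, Φ, ρ, hη, hκ, hm, hb, h₁, h₂, h₃, h₄, h₅, h₆, h₇, h₈, h₉, h₁₀, h₁₁⟩ :=
    h
  exact ⟨{
    η := η, κ := κ, m := m, b := b, B := B, τ₁ := τ₁, Φ := Φ, ρ := ρ, η_pos := hη
    κ_pos := hκ, m_pos := hm, b_pos := hb, contMDiffOn := h₁, isOpenEmbedding := h₂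
    eqOn_chart := h₃, supCkENorm_metricInCoords_le := h₄, uniform := h₅, contDiffOn_ρ := h₆
    supCkENorm_ρ_le := h₇, radialGraph_mem := h₈, eventually_lt_radius := h₉, achronal := h₁₀
    pencil := fun τ hτ _ hpb ↦ h₁₁ τ hτ hpb }⟩

/-- **`RedShiftedCollar` is the existence of a `RedShiftedCollarWitness`** (the structured
reading of the verbatim block). [folklore] -/
theorem redShiftedCollar_iff_nonempty_witness :
    𝓢.RedShiftedCollar Λ c M a τ₀ chart ↔ Nonempty (𝓢.RedShiftedCollarWitness Λ c M a τ₀ chart) :=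
  ⟨RedShiftedCollar.nonempty_witness, fun ⟨w⟩ ↦ w.redShiftedCollar⟩

/-- **A red-shifted collar from `τ₀` on is one from every later `τ₀'` on** (monotonicity in the
initial late time; `RedShiftedCollarWitness.ofLE`). [folklore] -/
theorem RedShiftedCollar.of_le (h : 𝓢.RedShiftedCollar Λ c M a τ₀ chart) {τ₀' : ℝ}
    (hτ : τ₀ ≤ τ₀') : 𝓢.RedShiftedCollar Λ c M a τ₀' chart := by
  obtain ⟨w⟩ := h.nonempty_witness
  exact (w.ofLE hτ).redShiftedCollar

end Spacetime

end Literature.Geometry.Lorentzian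

end
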